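import Summits.MatrixMultiplication.OmegaCensus.STPP211TFirstEngine
import Summits.MatrixMultiplication.OmegaCensus.STPPSmallPatternKernelBits
import Mathlib.Tactic.Ring
import Mathlib.Tactic.Linarith
import Summits.MatrixMultiplication.OmegaCensus.STPP211Z2pow5RoomReflectA
import Literature.Computability.Complexity.BlockTuples
import Literature.Barriers.RiemannHypothesis.TuranPartialSumsCheckArith

/-!
# ω-census, `(2,1,1)^k` T-first kernel engine — reflection A: bit lemmas for the packed-lane state

HONEST FRAMING (pub-omega census; verbatim): lottery ticket; floor = certified bounds/negative ranges.
Census STRUCTURE bookkeeping of the STPP track (seat pub-omega-stpp-1, gen 38; STRUCTURE row B5, the threshold column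
`T1(H) = max {k : (2,1,1)^k ⊆ H}`), not progress on `ω`: small patterns in small groups bound no exponent.

First reflection file for `STPP211TFirstEngine.lean`: the semantics of the engine's constants and bit operations as
`Nat.testBit` statements — repeated lanes (`repLanes`), the constants of `mkTC` at a position `64 + l·W + y`, lane reading
(`laneVal`), the kill pattern of a placement (`((EPl · 2^a) >>> n) &&& lown` = every lane rotated by `a`), the pair cut,
the state update (salt-insensitive above bit `64`), `allLow`, and generic OR-folds of shifted lanes (`epOf`, `epAll`).
Nothing here mentions groups; `…ReflectB` (placement search) and `…ReflectC` (canonical `c`-sets, normal form, Def. 5.1) follow.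

References: H. Cohn, R. Kleinberg, B. Szegedy, C. Umans, *Group-theoretic algorithms for matrix multiplication*, FOCS 2005
(arXiv:math/0511460), Def. 5.1.  Desk record: pub-omega HOME `pub-omega-stpp-1-g38/`.
-/

namespace Summit.MatrixMultiplication.OmegaCensus

namespace STPP211T

open STPP211Neg
open Literature.Computability.Complexity (div_mod_block)
open Summit.MatrixMultiplication.OmegaCensus.T1Z2p5 (testBit_lowMask)
open Literature.Barriers.RiemannHypothesis.TuranCheck (beq_true_iff)

/-! ## 1. Generic bit lemmas -/

/-- `lowMask k = 2^k − 1`. -/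
theorem lowMask_eq (k : ℕ) : lowMask k = 2 ^ k - 1 := by
  show Nat.sub (Nat.shiftLeft 1 k) 1 = _
  rw [shiftLeft_eq', sub_eq', Nat.one_shiftLeft]

/-- `lowMask k < 2^k`. -/
theorem lowMask_lt (k : ℕ) : lowMask k < 2 ^ k := by
  rw [lowMask_eq]; exact Nat.sub_lt Nat.one_le_two_pow Nat.one_pos

/-- A number with a set bit is nonzero. -/
theorem ne_zero_of_testBit {F x : ℕ} (h : F.testBit x = true) : F ≠ 0 := by
  rintro rfl; simp at h

/-- `2^i ≠ 0`. -/
theorem two_pow_ne_zero' (i : ℕ) : (2 : ℕ) ^ i ≠ 0 := Nat.pos_iff_ne_zero.1 (Nat.two_pow_pos i)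

/-- `Nat.div` is `/`. -/ theorem div_eq' (a b : ℕ) : Nat.div a b = a / b := rfl

/-- `lowBit 0 = 0`. -/
theorem lowBit_zero : lowBit 0 = 0 := by decide

/-- `lowBit G` for `G ≠ 0` is a power of two sitting on a set bit of `G`. -/
theorem lowBit_eq_two_pow {G : ℕ} (hG : G ≠ 0) : ∃ i, G.testBit i = true ∧ lowBit G = 2 ^ i := by
  obtain ⟨i, hi, hL, -, -⟩ := lowBit_spec hG
  exact ⟨i, hi, hL⟩

/-- If `lowBit x = 2^i` and `lowBit x ≠ 0` then bit `i` of `x` is set. -/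
theorem testBit_of_lowBit {x i : ℕ} (h : lowBit x = 2 ^ i) : x.testBit i = true := by
  by_cases hx : x = 0
  · subst hx; rw [lowBit_zero] at h; exact absurd h.symm (two_pow_ne_zero' i)
  · obtain ⟨j, hj, hL⟩ := lowBit_eq_two_pow hx
    rw [hL] at h
    have : j = i := Nat.pow_right_injective (le_refl 2) h
    subst this; exact hj

/-- **`allLow` visits every set bit** (as its isolated power of two). -/
theorem allLow_spec (body : ℕ → Bool) : ∀ (fuel F : ℕ), F ≤ fuel → allLow fuel body F = true →
    ∀ x, F.testBit x = true → body (2 ^ x) = true := by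
  intro fuel
  induction fuel with
  | zero =>
      intro F hF _ x hx
      have : F = 0 := Nat.le_zero.1 hF
      subst this; simp at hx
  | succ fuel ih =>
      intro F hF h x hx
      have hF0 : F ≠ 0 := ne_zero_of_testBit hx
      have h' : (force (lowBit F) fun L => body L && allLow fuel body (Nat.xor F L)) = true := by
        have := h
        simp only [allLow] at this ⊢
        rw [IcosetW.beq_false_of_ne hF0] at this
        exact this
      rw [force_eq, Bool.and_eq_true] at h'
      obtain ⟨i, hi, hL, hrem, hbits⟩ := lowBit_spec hF0
      rw [hL] at h'
      by_cases hxi : x = i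
      · subst hxi; exact h'.1
      · have hrem' : Nat.xor F (2 ^ i) = Nat.land F (F - 1) := by rw [← hL]; exact hrem
        rw [hrem'] at h'
        refine ih (Nat.land F (F - 1)) ?_ h'.2 x ?_
        · have : F &&& (F - 1) ≤ F - 1 := Nat.and_le_right
          show F &&& (F - 1) ≤ fuel
          omega
        · rw [hbits x, hx]; simp [hxi]

/-- Disjunction over a list: a `true` has a witness. -/
theorem anyL_true {L : List ℕ} {f : ℕ → Bool} (h : anyL L f = true) : ∃ a ∈ L, f a = true := by
  induction L with
  | nil => exact absurd h (by simp [anyL])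
  | cons hd tl ih =>
      have h' : (f hd || anyL tl f) = true := h
      rw [Bool.or_eq_true] at h'
      rcases h' with h1 | h2
      · exact ⟨hd, by simp, h1⟩
      · obtain ⟨a, ha, hfa⟩ := ih h2
        exact ⟨a, by simp [ha], hfa⟩

/-- `headL` of a cons. -/ theorem headL_cons (x : ℕ) (L : List ℕ) : headL (x :: L) = x := rfl
/-- `lengthL` is `List.length`. -/
theorem lengthL_eq (L : List ℕ) : lengthL L = L.length := by
  induction L with
  | nil => rfl
  | cons hd tl ih => show Nat.add (lengthL tl) 1 = _; rw [ih]; rfl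

/-- Bits of `maskL`: the members of the list. -/
theorem testBit_maskL (L : List ℕ) (i : ℕ) : (maskL L).testBit i = decide (i ∈ L) := by
  induction L with
  | nil => simp [maskL]
  | cons t tl ih =>
      show (Nat.lor (maskL tl) (Nat.shiftLeft 1 t)).testBit i = _
      rw [lor_eq, shiftLeft_eq', Nat.testBit_lor, ih, Nat.one_shiftLeft, Nat.testBit_two_pow]
      by_cases h1 : i ∈ tl
      · simp [h1]
      · by_cases h2 : i = t
        · subst h2; simp
        · have h3 : ¬ t = i := fun h => h2 h.symm
          simp [h1, h2, h3]

/-- `beqL` is list equality. -/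
theorem beqL_true {R L : List ℕ} (h : beqL R L = true) : R = L := by
  induction R generalizing L with
  | nil => cases L with
    | nil => rfl
    | cons x L' => exact absurd h (by simp [beqL])
  | cons r R' ih =>
      cases L with
      | nil => exact absurd h (by simp [beqL])
      | cons x L' =>
          have h' : (Nat.beq r x && beqL R' L') = true := h
          rw [Bool.and_eq_true] at h'
          rw [beq_true_iff.1 h'.1, ih h'.2]

/-- `withTC` computes the reference context `mkTC`. -/
theorem withTC_eq {α : Type} (n K : ℕ) (units : List ℕ) (body : TC → α) :
    withTC n K units body = body (mkTC n K units) := by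
  unfold withTC; simp only [force_eq]; rfl

/-- `runRoots` is a conjunction over the root list (used to assemble chunked kernel evaluations). -/
theorem runRoots_append (n K : ℕ) (units : List ℕ) (R₁ R₂ : List (List ℕ)) :
    runRoots n K units (R₁ ++ R₂) = (runRoots n K units R₁ && runRoots n K units R₂) := by
  unfold runRoots; rw [withTC_eq, withTC_eq, withTC_eq, tsearchRoots_append]

/-! ## 2. OR-folds of shifted lanes -/

/-- The generic fold `Σ_{l<K} f(l) · 2^{lW}` of the engine (recursor form with `force`). -/
noncomputable def foldLanes (K W : ℕ) (f : ℕ → ℕ) : ℕ :=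
  @Nat.rec (fun _ => ℕ) 0 (fun l acc => force acc fun acc' => Nat.lor acc' (Nat.shiftLeft (f l) (Nat.mul l W))) K

/-- `foldLanes` unfolds. -/
theorem foldLanes_succ (K W : ℕ) (f : ℕ → ℕ) :
    foldLanes (K + 1) W f = (foldLanes K W f) ||| (f K <<< (K * W)) := by
  show force (foldLanes K W f) (fun acc' => Nat.lor acc' (Nat.shiftLeft (f K) (Nat.mul K W))) = _
  rw [force_eq]; rfl

/-- Lane arithmetic: `l < K`, `y < W` ⇒ `l·W + y < K·W`. -/
theorem lane_lt {l K y W : ℕ} (hl : l < K) (hy : y < W) : l * W + y < K * W := by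
  have h1 : l * W + y < l * W + W := by omega
  have h2 : l * W + W = (l + 1) * W := by rw [Nat.add_mul, Nat.one_mul]
  have h3 : (l + 1) * W ≤ K * W := Nat.mul_le_mul_right W hl
  omega

/-- **Bits of a lane fold**: with every `f l < 2^W` (`W > 0`), bit `i` is bit `i % W` of `f (i / W)` when `i < K·W`, else
clear. -/
theorem testBit_foldLanes (W : ℕ) (hW : 0 < W) (f : ℕ → ℕ) (hf : ∀ l, f l < 2 ^ W) :
    ∀ K i, (foldLanes K W f).testBit i = (decide (i < K * W) && (f (i / W)).testBit (i % W)) := by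
  intro K
  induction K with
  | zero => intro i; simp [foldLanes]
  | succ K ih =>
      intro i
      rw [foldLanes_succ, Nat.testBit_lor, ih, Nat.testBit_shiftLeft]
      have hKW : (K + 1) * W = K * W + W := by rw [Nat.add_mul, Nat.one_mul]
      by_cases h1 : i < K * W
      · have h2 : ¬ (i ≥ K * W) := by omega
        have h3 : i < (K + 1) * W := by omega
        simp [h1, h2, h3]
      · by_cases h3 : i < (K + 1) * W
        · have hy : i - K * W < W := by omega
          have hi : i = K * W + (i - K * W) := by omega
          have hdm := div_mod_block (k := K) hy
          rw [← hi] at hdm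
          have h2 : i ≥ K * W := by omega
          rw [hdm.1, hdm.2]
          simp [h1, h2, h3]
        · have h2 : i ≥ K * W := by omega
          have h4 : (f K).testBit (i - K * W) = false := by
            apply Nat.testBit_lt_two_pow
            exact lt_of_lt_of_le (hf K) (Nat.pow_le_pow_right Nat.two_pos (by omega))
          simp [h1, h3, h4]

/-- A lane fold with entries `< 2^W` is `< 2^{K·W}`. -/
theorem foldLanes_lt (K W : ℕ) (hW : 0 < W) (f : ℕ → ℕ) (hf : ∀ l, f l < 2 ^ W) :
    foldLanes K W f < 2 ^ (K * W) := by
  apply Nat.lt_pow_two_of_testBit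
  intro i hi
  rw [testBit_foldLanes W hW f hf]
  simp; omega

/-- `repLanes K W v` is the lane fold of the constant `v`. -/
theorem repLanes_eq (K W v : ℕ) : repLanes K W v = foldLanes K W (fun _ => v) := rfl

/-- Bits of `repLanes`. -/
theorem testBit_repLanes (K W v : ℕ) (hW : 0 < W) (hv : v < 2 ^ W) (i : ℕ) :
    (repLanes K W v).testBit i = (decide (i < K * W) && v.testBit (i % W)) := by
  rw [repLanes_eq, testBit_foldLanes W hW _ (fun _ => hv)]

/-! ## 3. Positions and the constants of `mkTC` -/

section Consts

variable (n K : ℕ) (units : List ℕ)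

/-- Field `n` of `mkTC`. -/
theorem mkTC_n : (mkTC n K units).n = n := rfl
/-- Field `K` of `mkTC`. -/
theorem mkTC_K : (mkTC n K units).K = K := rfl
/-- Field `W` of `mkTC`. -/
theorem mkTC_W : (mkTC n K units).W = 2 * n := rfl
/-- Field `KW` of `mkTC`. -/
theorem mkTC_KW : (mkTC n K units).KW = K * (2 * n) := rfl
/-- Field `fulln` of `mkTC`. -/
theorem mkTC_fulln : (mkTC n K units).fulln = lowMask n := rfl
/-- Field `units` of `mkTC`. -/
theorem mkTC_units : (mkTC n K units).units = units := rfl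
/-- Field `fuel` of `mkTC`. -/
theorem mkTC_fuel : (mkTC n K units).fuel = 2 * K + 1 := rfl
/-- Field `upK` of `mkTC`. -/
theorem mkTC_upK : (mkTC n K units).upK = K * (n + 64) := rfl
/-- Field `allKW` of `mkTC`. -/
theorem mkTC_allKW : (mkTC n K units).allKW = lowMask (K * (2 * n)) := rfl
/-- Field `lown` of `mkTC`. -/
theorem mkTC_lown : (mkTC n K units).lown = Nat.shiftLeft (repLanes K (2 * n) (lowMask n)) 64 := rfl
/-- Field `sent` of `mkTC`. -/
theorem mkTC_sent : (mkTC n K units).sent = Nat.shiftLeft (repLanes K (2 * n) (Nat.shiftLeft 1 n)) 64 := rfl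
/-- Field `ones` of `mkTC`. -/
theorem mkTC_ones : (mkTC n K units).ones = Nat.shiftLeft (repLanes K (2 * n) 1) 64 := rfl
/-- Field `call` of `mkTC`. -/
theorem mkTC_call : (mkTC n K units).call =
    Nat.lor (Nat.lor (mkTC n K units).lown (mkTC n K units).sent) (lowMask 64) := rfl
/-- Field `cut0` of `mkTC`. -/
theorem mkTC_cut0 : (mkTC n K units).cut0 = Nat.xor (mkTC n K units).call
    (Nat.shiftLeft (Nat.xor (lowMask n) (Nat.xor (lowMask (Nat.add (Nat.div n 2) 1)) 1)) 64) := rfl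

variable {n K}

/-- Bits of `lown` at a lane position: the codes (`y < n`). -/
theorem testBit_lown {l y : ℕ} (hl : l < K) (hy : y < 2 * n) :
    (mkTC n K units).lown.testBit (64 + l * (2 * n) + y) = decide (y < n) := by
  have hW : 0 < 2 * n := by omega
  have hv : lowMask n < 2 ^ (2 * n) := lt_of_lt_of_le (lowMask_lt n) (Nat.pow_le_pow_right Nat.two_pos (by omega))
  rw [mkTC_lown, shiftLeft_eq', Nat.testBit_shiftLeft, testBit_repLanes _ _ _ hW hv,
    decide_eq_true (show 64 + l * (2 * n) + y ≥ 64 by omega), Bool.true_and,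
    show 64 + l * (2 * n) + y - 64 = l * (2 * n) + y by omega, (div_mod_block hy).2, testBit_lowMask,
    decide_eq_true (lane_lt hl hy), Bool.true_and]

/-- Bits of `sent` at a lane position: the sentinel (`y = n`). -/
theorem testBit_sent {l y : ℕ} (hl : l < K) (hy : y < 2 * n) :
    (mkTC n K units).sent.testBit (64 + l * (2 * n) + y) = decide (y = n) := by
  have hW : 0 < 2 * n := by omega
  have hv : Nat.shiftLeft 1 n < 2 ^ (2 * n) := by
    rw [shiftLeft_eq', Nat.one_shiftLeft]; exact Nat.pow_lt_pow_right (by norm_num) (by omega)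
  rw [mkTC_sent, shiftLeft_eq', Nat.testBit_shiftLeft, testBit_repLanes _ _ _ hW hv,
    decide_eq_true (show 64 + l * (2 * n) + y ≥ 64 by omega), Bool.true_and,
    show 64 + l * (2 * n) + y - 64 = l * (2 * n) + y by omega, (div_mod_block hy).2,
    decide_eq_true (lane_lt hl hy), Bool.true_and, shiftLeft_eq', Nat.one_shiftLeft, Nat.testBit_two_pow]
  by_cases h : y = n
  · subst h; simp
  · have h' : ¬ n = y := fun e => h e.symm
    simp [h, h']

/-- Bits of `ones` at a lane position: bit `0` of the lane. -/
theorem testBit_ones {l y : ℕ} (hl : l < K) (hy : y < 2 * n) :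
    (mkTC n K units).ones.testBit (64 + l * (2 * n) + y) = decide (y = 0) := by
  have hW : 0 < 2 * n := by omega
  have h1 : ∀ i, Nat.testBit 1 i = decide (i = 0) := fun i => by cases i <;> simp [Nat.testBit_succ]
  rw [mkTC_ones, shiftLeft_eq', Nat.testBit_shiftLeft, testBit_repLanes _ _ _ hW (Nat.one_lt_two_pow (by omega)),
    decide_eq_true (show 64 + l * (2 * n) + y ≥ 64 by omega), Bool.true_and,
    show 64 + l * (2 * n) + y - 64 = l * (2 * n) + y by omega, (div_mod_block hy).2,
    decide_eq_true (lane_lt hl hy), Bool.true_and, h1]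

/-- Bits of `call` at a lane position: codes and sentinel (`y ≤ n`). -/
theorem testBit_call {l y : ℕ} (hl : l < K) (hy : y < 2 * n) :
    (mkTC n K units).call.testBit (64 + l * (2 * n) + y) = decide (y ≤ n) := by
  rw [mkTC_call, lor_eq, lor_eq, Nat.testBit_lor, Nat.testBit_lor, testBit_lown units hl hy, testBit_sent units hl hy,
    testBit_lowMask]
  have h1 : ¬ (64 + l * (2 * n) + y < 64) := by omega
  by_cases h2 : y < n
  · simp [h1, h2, le_of_lt h2]
  · by_cases h3 : y = n
    · simp [h3]
    · have h4 : ¬ (y ≤ n) := by omega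
      simp [h1, h2, h3, h4]

/-- Bits of `call` below `64` (the salt region): all set. -/
theorem testBit_call_low {i : ℕ} (hi : i < 64) : (mkTC n K units).call.testBit i = true := by
  rw [mkTC_call, lor_eq, Nat.testBit_lor, testBit_lowMask]
  simp [hi]

/-- Bits of `cut0` at a lane position: outside lane `0` like `call`; in lane `0` the codes in `[1, n/2]` and the sentinel. -/
theorem testBit_cut0 {l y : ℕ} (hl : l < K) (hy : y < 2 * n) :
    (mkTC n K units).cut0.testBit (64 + l * (2 * n) + y) =
      if l = 0 ∧ y < n then decide (1 ≤ y ∧ y ≤ n / 2) else decide (y ≤ n) := by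
  have h1 : ∀ i, Nat.testBit 1 i = decide (i = 0) := fun i => by cases i <;> simp [Nat.testBit_succ]
  rw [mkTC_cut0, xor_eq, Nat.testBit_xor, testBit_call units hl hy, shiftLeft_eq', Nat.testBit_shiftLeft,
    decide_eq_true (show 64 + l * (2 * n) + y ≥ 64 by omega), Bool.true_and,
    show 64 + l * (2 * n) + y - 64 = l * (2 * n) + y by omega, xor_eq, xor_eq, Nat.testBit_xor, Nat.testBit_xor,
    testBit_lowMask, testBit_lowMask, add_eq', div_eq', h1]
  by_cases hl0 : l = 0
  · subst hl0
    simp only [zero_mul, zero_add, true_and]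
    by_cases hyn : y < n
    · rw [if_pos hyn]
      by_cases hy0 : y = 0
      · subst hy0
        have h1 : (0 : ℕ) < n / 2 + 1 := by omega
        simp [hyn, h1]
      · by_cases hy2 : y < n / 2 + 1
        · have : (1 ≤ y ∧ y ≤ n / 2) := ⟨Nat.pos_of_ne_zero hy0, by omega⟩
          simp [hyn, le_of_lt hyn, hy0, hy2, this]
        · have : ¬ (1 ≤ y ∧ y ≤ n / 2) := fun h => hy2 (by omega)
          simp [hyn, le_of_lt hyn, hy0, hy2, this]
    · rw [if_neg hyn]
      have hy2 : ¬ (y < n / 2 + 1) := by omega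
      have hy0 : ¬ (y = 0) := by omega
      simp [hyn, hy2, hy0]
  · rw [if_neg (fun h => hl0 h.1)]
    have h1l : 1 ≤ l := Nat.pos_of_ne_zero hl0
    have hge : 2 * n ≤ l * (2 * n) + y := by
      have : 1 * (2 * n) ≤ l * (2 * n) := Nat.mul_le_mul_right _ h1l
      omega
    have hpos : ¬ (l * (2 * n) + y < n) := by omega
    have hpos2 : ¬ (l * (2 * n) + y < n / 2 + 1) := by omega
    have hn : ¬ (n = 0) := by omega
    simp [hpos, hpos2, hl0, hn]

end Consts

end STPP211T

end Summit.MatrixMultiplication.OmegaCensus
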